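import Summits.BirchSwinnertonDyer.BirchSwinnertonDyer.Theorems.ErratumRoadFiveBdvCalibrationSplitRDefs
import HarnessLib

/-!
# The BDV-calibration split of `A♭-fam` ON THE AMENDED EXPONENT `R` — the glue re-proved on R
# (crux stmt-BirchSwinnertonDyer-19715, (α2) item stmt-BirchSwinnertonDyer-33169 `ErratumRoadFive.KatoValuationIneqNonsplitAtFive`)

LEAD `bsd-line-er5-p1` g20, pen word `d2R` P1 (2026-08-31T03:03:23Z).  The four glue theorems of
`Theorems/ErratumRoadFiveBdvCalibrationSplit.lean` (p782257) and the supply recomposition of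
`Theorems/ErratumRoadFiveBdvCalibrationSplitCalibratorDefs.lean` (p782155) RE-PROVED ON THE AMENDED EXPONENT
`bdvExplicitExponentR … N = bdvExplicitExponent … − v_p φ(N)` (`ErratumRoadFiveBdvCalibrationSplitRDefs`): same proofs,
`R` statements in place of the originals (S2a `CalibratorSupply` and S2c `CalibratorDataRealisable` unchanged, imported);
the conclusion of the main glue is the amended A♭-fam text `AFlatFamStatementR` token for token (`− (padicValNat p
(Nat.totient N) : ℤ)` right after the Γ₀ pair).  Originals untouched (superseded, not refuted).

* `eisensteinPeriodRatioValuationR_of_supply_of_portR` : S2a ∧ S2c ∧ S2bR ⟹ S2R at an admissible `(L, p)`;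
* `katoBdpCrossingNonsplitFamilyR_of_bdvChainR_of_calibrationR` : S1R → (∀ p ≥ 5, ∀ admissible L, S2R L p) → A♭-famR
  (Step 1: the calibrator, exact on R, pins `V p d_L = 0`; Step 2: S1R at the target with `a_p = −1`,
  `bdvExplicitExponentR_of_not_split`);
* `aFlatFamR_of_bdvChainR_of_calibrationR`, `aFlatFamR_of_bdvChainR_of_supply_of_portR` (named folds);
* `bdvChainExplicitNonsplitR_of_aFlatFamR_of_portR` : A♭-famR ∧ S2bR ⟹ S1R (`V = 0`).

The BY-NAME composition A♭-famR → `Theses.ErratumRoadFive.KatoValuationIneqNonsplitAtFive` (the ν-free crux, slack `ν ≥ 0`)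
is `ErratumRoadFiveBstwDoorValuationIneqR`.  NOTHING here proves S1R, S2R, S2bR, S2a, S2c (OPEN, hypotheses), nor 33169,
19715 or any route item; typed ≠ proved; no summit statement is proved; BSD is proved for no curve.
-/

set_option autoImplicit false
-- D-0017: single-problem summit, so `Summit.BirchSwinnertonDyer.BirchSwinnertonDyer.…` repeats a namespace BY DESIGN.
set_option linter.dupNamespace false

noncomputable section

open scoped Classical NumberField TensorProduct BigOperators

namespace Summit.BirchSwinnertonDyer.BirchSwinnertonDyer.Theorems.ErratumRoadFiveBdvCalibrationSplitR

open Field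
open Literature.NumberTheory.GaloisRepresentations
open Literature.NumberTheory.EllipticCurves Literature.NumberTheory.EllipticCurves.Kato2004
open Literature.NumberTheory.EllipticCurves.Kato2004.EulerSystemValues
open Literature.NumberTheory.EllipticCurves.Rank1Residual
open Literature.NumberTheory.EllipticCurves.Rank1Residual.Typed
open Literature.NumberTheory.EllipticCurves.ModularForms
open Literature.NumberTheory.EllipticCurves.Castella2018
open Summit.BirchSwinnertonDyer.Rank1Residual
open Summit.BirchSwinnertonDyer.BirchSwinnertonDyer.Theorems.ErratumRoadFiveBdvCalibrationSplit
open IsDedekindDomain (HeightOneSpectrum)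
open CongruenceSubgroup (Gamma0)

/-! ## §1 The calibrator atom on R recomposes from its three pieces -/

/-- Recomposition of the calibrator atom ON R from SUPPLY (S2a) ∧ REALISABILITY (S2c) ∧ BSTW-on-R (S2bR) (proved). -/
theorem eisensteinPeriodRatioValuationR_of_supply_of_portR (p : ℕ) [Fact p.Prime] (h5 : 5 ≤ p) (L : Type)
    [Field L] [NumberField L] (hLq : IsImaginaryQuadratic L) (hHp : SatisfiesHeegnerHypothesis p L)
    (hd4 : NumberField.discr L < -4) (hodd : Odd (NumberField.discr L)) (hsup : CalibratorSupply L p)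
    (hreal : CalibratorDataRealisable) (hport : BstwIntegralPerrinRiouGoodOrdinaryR) :
    EisensteinPeriodRatioValuationR L p := by
  obtain ⟨W, hE, hGM, hrk, hirr, hgo, hS, hH, hLt⟩ := hsup
  obtain ⟨hCS, hMF, hMFi, hNZ, Dt, Hd, w₀, PL, hPL, hc, s, k, hs, hk, W', hE', D, hDf, hmin, K, hK, γ, I, hγ, hp,
    N, hN, f, hf, ι, q, Λ, c, d₁, a, A, d', z, x, y, perRatio, hq, hzeta, hy, hA, hcg, hd, hdd, hR, hper0, hper,
    ι', κ, γ', ΩK, Ωp, Λf, hκ, hγ', hΩK, hBDP, X, hXv, σ, hσ, hσ0⟩ :=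
    hreal p h5 L hLq hHp hd4 hodd W hrk hirr hgo hS hH hLt
  exact ⟨W, hE, hGM, hCS, hMF, hMFi, hNZ, hrk, hirr, hgo, hS, hH, hLt, Dt, Hd, w₀, PL, hPL, hc, s, k, hs, hk, W',
    hE', D, hDf, hmin, K, hK, γ, I, hγ, hp, N, hN, f, hf, ι, q, Λ, c, d₁, a, A, d', z, x, y, perRatio, hq, hzeta,
    hy, hA, hcg, hd, hdd, hR, hper0, hper, ι', κ, γ', ΩK, Ωp, Λf, hκ, hγ', hΩK, hBDP, X, hXv, σ, hσ, hσ0,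
    hport W p hrk hirr hgo h5 hS L hLq hH hHp hd4 hodd hLt Dt Hd w₀ PL hPL hc s k hs hk W' D hDf hmin K hK γ I hγ
      hp N f hf ι q Λ c d₁ a A d' z x y perRatio hq hzeta hy hA hcg hd hdd hR hper0 hper ι' κ γ' ΩK Ωp Λf hκ hγ'
      hΩK hBDP X hXv σ hσ hσ0⟩

/-! ## §2 (glue on R) The proved recomposition — conclusion = the amended A♭-fam text, token for token -/

/-- **The proved recomposition on the amended exponent.**  Conclusion = `AFlatFamStatementR` unfolded (the registered
A♭-fam text with `− v_p φ(N)` after the Γ₀ pair).  Proof as on the registered exponent: S2R at `(L, p)` yields a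
calibrator with exact exponent `e′_R`; S1R at the calibrator yields `e′_R − V p d_L` for the same norm; `p^·` is
injective, so `V p d_L = 0`; S1R at the target (a class member by `nonExceptionalRankOneAt_of_classX11b`) gives the
amended exponent once the `a_p`-term is removed by `bdvExplicitExponentR_of_not_split`. -/
theorem katoBdpCrossingNonsplitFamilyR_of_bdvChainR_of_calibrationR
    (h₁ : BdvChainExplicitNonsplitR)
    (h₂ : ∀ (p : ℕ) [Fact p.Prime], 5 ≤ p → ∀ (L : Type) [Field L] [NumberField L],
      IsImaginaryQuadratic L → SatisfiesHeegnerHypothesis p L → NumberField.discr L < -4 →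
      Odd (NumberField.discr L) → EisensteinPeriodRatioValuationR L p) :
    ∀ (W : WeierstrassCurve ℚ) [W.IsElliptic] [W.IsGloballyMinimal] (p : ℕ) [Fact p.Prime]
      [ContinuousSMul ℤ_[p] (W.tateModule p)] [Module.Free ℤ_[p] (W.tateModule p)]
      [Module.Finite ℤ_[p] (W.tateModule p)] [NeZero (W.conductorNorm ℤ)],
      ClassX11b W p → 5 ≤ p → Surj W p → ¬ W.HasSplitMultiplicativeReductionAtPrime p →
      ∀ (L : Type) [Field L] [NumberField L], IsImaginaryQuadratic L →
        SatisfiesHeegnerHypothesis (W.conductorNorm ℤ) L → SatisfiesHeegnerHypothesis p L →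
        NumberField.discr L < -4 → Odd (NumberField.discr L) →
        (W.quadraticTwist (NumberField.discr L : ℚ)).entireLFunction 1 ≠ 0 →
      ∀ (Dt : ModularParametrizationData W (W.conductorNorm ℤ))
        (Hd : HeegnerDatum (W.conductorNorm ℤ) (NumberField.discr L)) (w₀ : NumberField.InfinitePlace L)
        (PL : (W.baseChange L).toAffine.Point),
        WeierstrassCurve.Affine.Point.map w₀.embedding.toRatAlgHom PL = heegnerPointComplex Dt Hd →
        ¬ (p : ℤ) ∣ Dt.c →
      ∀ (s : ℚ) (k : ℤ),
        (Real.sqrt ((NumberField.discr L).natAbs : ℝ) : ℂ) *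
            (W.quadraticTwist (NumberField.discr L : ℚ)).entireLFunction 1 = (s : ℂ) * (minusPeriod Dt.f : ℂ) →
        (Dt.c : ℝ) * minusPeriod Dt.f = k * W.imaginaryPeriodRat →
      ∀ (W' : WeierstrassCurve ℚ) [W'.IsElliptic] (D : ModularParametrizationData W' (W.conductorNorm ℤ)),
        D.f = Dt.f →
        (∀ (W'' : WeierstrassCurve ℚ) [W''.IsElliptic] (D'' : ModularParametrizationData W'' (W.conductorNorm ℤ)),
            D''.f = D.f → D.modularDegree ≤ D''.modularDegree) →
      ∀ (K : ZpExtension ℚ p) (hK : K.IsCyclotomic) (γ : absoluteGaloisGroup ℚ)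
        (I : IwasawaH1Data W p K γ), K.IsTopGenerator γ →
      ∀ (hp : p ≠ 2) (N : ℕ) [NeZero N] (f : CuspForm (Gamma0 N) 2), IsNewformOf W f →
      ∀ (ι : (n : ℕ) → (CyclotomicField n ℚ →+* ℂ)) (q : ℚ)
        (Λ : ∀ (m : ℕ) (r : Finset (HeightOneSpectrum (𝓞 ℚ))),
          H1 (tateRep W p) (cycSubgroup p m r) →ₗ[ℤ_[p]] ℚ_[p] ⊗[ℚ] CyclotomicField (cycLevel p m r) ℚ)
        (c d₁ a : ℤ) (A : ℕ) (d' : ℤ)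
        (z : ∀ (m : ℕ) (r : (cyclotomicLevelsRat p (badPlaces c d₁ A N)).Ideals),
          H1 (tateRep W p) ((cyclotomicLevelsRat p (badPlaces c d₁ A N)).level m r.1))
        (x : ∀ (m : ℕ) (r : (cyclotomicLevelsRat p (badPlaces c d₁ A N)).Ideals),
          CyclotomicField (cycLevel p m r.1) ℚ)
        (y : I.H) (perRatio : ℚ),
        q ≠ 0 → ZetaBody W p f ι ((q : ℚ) : ℝ) Λ c d₁ a A z x →
        (∀ n : ℕ, I.proj n y =
          levelToLayer W p hK hp (badPlaces c d₁ A N) n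
            (z (n + 1) (cyclotomicLevelsRat p (badPlaces c d₁ A N)).idealOne)) →
        0 < A → Int.gcd c (6 * p * A) = 1 → Int.gcd d₁ (6 * p * N) = 1 → (d₁ : ℤ) * d' ≡ 1 [ZMOD (A : ℤ)] →
        ratCuspFactor f true c d₁ a A d' ≠ 0 → perRatio ≠ 0 →
        plusPeriod f = ((perRatio : ℚ) : ℝ) * W.realPeriodRat →
      ∀ (ι' : PadicAlgCl p ≃+* ℂ)
        (κ : ZpExtension L p) (γ' : absoluteGaloisGroup L) (ΩK : ℂ) (Ωp : (unrIntegers p)ˣ) (Λf : UnrSeries p),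
        κ.IsAnticyclotomic → κ.IsTopGenerator γ' → ΩK ≠ 0 →
        IsBDPLFunction ι' (X11b.primeOfEmbeddingDatum p ι' w₀.embedding) κ γ' Dt.f ΩK
          ((Ωp : unrIntegers p) : ℂ_[p]) Λf →
      ∀ (X : ℂ_[p]), Λf.HasValueAt 0 X →
      ∀ σ : ℚ_[p], HasLocPKummerLog W p (bottomClass W p K I y) σ → σ ≠ 0 →
        ‖X‖ = (p : ℝ) ^ (1 + padicValInt p Dt.c - padicValRat p s - padicValInt p k -
            ((padicValNat p (congruenceNumber Dt.f) : ℤ) - padicValNat p D.modularDegree) -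
            (padicValNat p (Nat.totient N) : ℤ) -
            (σ.valuation + padicValRat p (perRatio /
              (q * ratCuspFactor f true c d₁ a A d' * ∏ ℓ ∈ A.primeFactors.erase p, eulerFactorAtOne W N ℓ)))) := by
  intro W _ _ p _ _ _ _ _ hX h5 hS hns L _ _ hLq hH hHp hd4 hodd hLt Dt Hd w₀ PL hPL hc s k hs hk W' _ D hDf hmin
    K hK γ I hγ hp N _ f hf ι q Λ c d₁ a A d' z x y perRatio hq hzeta hy hA hcg hd hdd' hR hper0 hper
    ι' κ γ' ΩK Ωp Λf hκ hγ' hΩK hBDP X hXv σ hσ hσ0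
  obtain ⟨V, hV⟩ := h₁
  have hp1 : (1 : ℝ) < p := by exact_mod_cast (Fact.out : p.Prime).one_lt
  have hp0 : (0 : ℝ) < p := lt_trans one_pos hp1
  -- Step 1: the calibrator at `(L, p)` pins `V p d_L = 0`.
  have hV0 : V p (NumberField.discr L) = 0 := by
    obtain ⟨W₁, hE₁, hGM₁, hCS₁, hMF₁, hMFi₁, hNZ₁, hrk₁, hirr₁, hgo₁, hS₁, hH₁, hLt₁, Dt₁, Hd₁, w₁, PL₁, hPL₁,
      hc₁, s₁, k₁, hs₁, hk₁, W₁', hE₁', D₁, hDf₁, hmin₁, K₁, hK₁, γ₁, I₁, hγ₁, hp₁, N₁, hN₁, f₁, hf₁, ι₁, q₁, Λ₁,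
      c₁, e₁, a₁, A₁, e₁', z₁, x₁, y₁, perRatio₁, hq₁, hzeta₁, hy₁, hA₁, hcg₁, hd₁, hdd₁, hR₁, hper0₁, hper₁,
      ι₁', κ₁, γ₁', ΩK₁, Ωp₁, Λf₁, hκ₁, hγ₁', hΩK₁, hBDP₁, X₁, hXv₁, σ₁, hσ₁, hσ0₁, hnorm₁⟩ :=
      h₂ p h5 L hLq hHp hd4 hodd
    have h := hV W₁ p ⟨hrk₁, hirr₁, Or.inr hgo₁⟩ h5 hS₁ L hLq hH₁ hHp hd4 hodd hLt₁ Dt₁ Hd₁ w₁ PL₁ hPL₁ hc₁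
      s₁ k₁ hs₁ hk₁ W₁' D₁ hDf₁ hmin₁ K₁ hK₁ γ₁ I₁ hγ₁ hp₁ N₁ f₁ hf₁ ι₁ q₁ Λ₁ c₁ e₁ a₁ A₁ e₁' z₁ x₁ y₁
      perRatio₁ hq₁ hzeta₁ hy₁ hA₁ hcg₁ hd₁ hdd₁ hR₁ hper0₁ hper₁ ι₁' κ₁ γ₁' ΩK₁ Ωp₁ Λf₁ hκ₁ hγ₁' hΩK₁ hBDP₁
      X₁ hXv₁ σ₁ hσ₁ hσ0₁
    rw [hnorm₁] at h
    have he := zpow_right_injective₀ hp0 hp1.ne' h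
    omega
  -- Step 2: S1 at the target curve, with `V p d_L = 0` and `a_p = −1`.
  have h := hV W p (nonExceptionalRankOneAt_of_classX11b W p hX hns) h5 hS L hLq hH hHp hd4 hodd hLt Dt Hd w₀
    PL hPL hc s k hs hk W' D hDf hmin K hK γ I hγ hp N f hf ι q Λ c d₁ a A d' z x y perRatio hq hzeta hy hA hcg
    hd hdd' hR hper0 hper ι' κ γ' ΩK Ωp Λf hκ hγ' hΩK hBDP X hXv σ hσ hσ0
  rw [hV0, sub_zero, bdvExplicitExponentR_of_not_split W p hX.2.2.1 hns h5] at h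
  exact h

/-! ## §3 Certificates on R: the named fold, the three-piece corollary and `S1R ⟸ A♭-famR ∧ S2bR` -/

/-- `S1R ∧ (∀ admissible (L,p), S2R) ⟹ A♭-famR` with the conclusion folded into the named `Prop` `AFlatFamStatementR`. -/
theorem aFlatFamR_of_bdvChainR_of_calibrationR (h₁ : BdvChainExplicitNonsplitR)
    (h₂ : ∀ (p : ℕ) [Fact p.Prime], 5 ≤ p → ∀ (L : Type) [Field L] [NumberField L],
      IsImaginaryQuadratic L → SatisfiesHeegnerHypothesis p L → NumberField.discr L < -4 →
      Odd (NumberField.discr L) → EisensteinPeriodRatioValuationR L p) :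
    AFlatFamStatementR := by
  unfold AFlatFamStatementR
  exact katoBdpCrossingNonsplitFamilyR_of_bdvChainR_of_calibrationR h₁ h₂

/-- The three-piece corollary on R: S1R ∧ (supply at every admissible `(L,p)`) ∧ S2c ∧ S2bR ⟹ `A♭-famR`. -/
theorem aFlatFamR_of_bdvChainR_of_supply_of_portR (h₁ : BdvChainExplicitNonsplitR)
    (hsup : ∀ (p : ℕ) [Fact p.Prime], 5 ≤ p → ∀ (L : Type) [Field L] [NumberField L],
      IsImaginaryQuadratic L → SatisfiesHeegnerHypothesis p L → NumberField.discr L < -4 →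
      Odd (NumberField.discr L) → CalibratorSupply L p)
    (hreal : CalibratorDataRealisable) (hport : BstwIntegralPerrinRiouGoodOrdinaryR) : AFlatFamStatementR :=
  aFlatFamR_of_bdvChainR_of_calibrationR h₁ (fun p _ h5 L _ _ hLq hHp hd4 hodd =>
    eisensteinPeriodRatioValuationR_of_supply_of_portR p h5 L hLq hHp hd4 hodd (hsup p h5 L hLq hHp hd4 hodd)
      hreal hport)

/-- Anti-costume certificate on R, one direction: S1R is IMPLIED by `A♭-famR ∧ S2bR` (take `V = 0`).  (It implies
neither: S1R alone fixes no value of `V`.) -/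
theorem bdvChainExplicitNonsplitR_of_aFlatFamR_of_portR (hA : AFlatFamStatementR)
    (hport : BstwIntegralPerrinRiouGoodOrdinaryR) : BdvChainExplicitNonsplitR := by
  refine ⟨fun _ _ => 0, ?_⟩
  intro W _ _ p _ _ _ _ _ hcls h5 hS L _ _ hLq hH hHp hd4 hodd hLt Dt Hd w₀ PL hPL hc s k hs hk W' _ D hDf hmin
    K hK γ I hγ hp N _ f hf ι q Λ c d₁ a A d' z x y perRatio hq hzeta hy hA0 hcg hd hdd' hR hper0 hper
    ι' κ γ' ΩK Ωp Λf hκ hγ' hΩK hBDP X hXv σ hσ hσ0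
  simp only [sub_zero]
  rcases hcls with ⟨hrk, hirr, hmult | hgo⟩
  · have hp2 : p ≠ 2 := by omega
    have h := hA W p ⟨hrk, hp2, hmult.1, hirr⟩ h5 hS hmult.2 L hLq hH hHp hd4 hodd hLt Dt Hd w₀ PL hPL hc s k
      hs hk W' D hDf hmin K hK γ I hγ hp N f hf ι q Λ c d₁ a A d' z x y perRatio hq hzeta hy hA0 hcg hd hdd' hR
      hper0 hper ι' κ γ' ΩK Ωp Λf hκ hγ' hΩK hBDP X hXv σ hσ hσ0
    rw [bdvExplicitExponentR_of_not_split W p hmult.1 hmult.2 h5]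
    exact h
  · exact hport W p hrk hirr hgo h5 hS L hLq hH hHp hd4 hodd hLt Dt Hd w₀ PL hPL hc s k hs hk W' D hDf hmin K
      hK γ I hγ hp N f hf ι q Λ c d₁ a A d' z x y perRatio hq hzeta hy hA0 hcg hd hdd' hR hper0 hper ι' κ γ' ΩK
      Ωp Λf hκ hγ' hΩK hBDP X hXv σ hσ hσ0

end Summit.BirchSwinnertonDyer.BirchSwinnertonDyer.Theorems.ErratumRoadFiveBdvCalibrationSplitR

end
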